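import Mathlib

/-!
# `Balaban1983to89.B12LaurentSplitting522Proof` — T. Bałaban, *Renormalization group approach to lattice gauge field theories. I. Generation of effective actions in a small field approximation and a coupling constant renormalization in four dimensions*, Commun. Math. Phys. **109** (1987) 249–301 [Balaban1987RG1]: the one-variable LAURENT SPLITTING of §5, p. 294 [PDF 46], with its three normalised forms ((5.22)–(5.25), pp. 294–295) — PROVED

statement-level skeleton of published theorems with citation tags; proofs where landed; nothing here is a claim about the Yang–Mills mass gap

PDF held: `paper:balaban1987-cmp109-rg-i-small-field` (journal page = PDF page + 248); read from the 300-dpi renders of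
pp. 294–295 [PDF 46–47] (`run/shared/lean/pub/pub-balaban/b2b-balaban-ref1/pages/1987-cmp109-rg-I-small-field/`).

WHAT IS REPRODUCED.  SKELETON row `B12.Eq5.22-5.26` (Phase-2 reserve R2 of `PHASE2-TARGETS.md` §G.3, seat p10).  The
row's pre-existing declarations are `B12Sec5Algebra.F11/F12/F21` (the (5.26) sums, d = 4, as DEFINITIONS) and
`B12Sec5Algebra.opS/opM/opN` (the one-variable forms `g(z) + g(z⁻¹)`, `g(z) − zg(z⁻¹)`, `g(z) − z⁻¹g(z⁻¹)` of p. 294);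
what ROWS-B12 (r09) records as ABSENT is the DECOMPOSITION THEOREM — the complex analysis behind (5.22)–(5.25).  This
file proves it in one complex variable, exactly as printed on p. 294: *"Now, a given function f(z) analytic on the
ring {e^{−δ₁} < |z| < e^{δ₁}} can be represented as f(z) = g⁺(z) + g⁻(z⁻¹), where g⁺(z), g⁻(z) are analytic on the disc
{|z| < e^{δ₁}}. This representation is obtained by taking regular and singular parts of the Laurent expansion. It is
unique up to an additive constant, and it can be made unique requiring some normalization conditions. … If the index
of this component is different from μ, ν, then the transformation law in the one variable is f(z⁻¹) = f(z). The
normalization condition g⁺(0) = g⁻(0) implies then g⁻(z) = g⁺(z), and we have the representation f(z) = g(z) + g(z⁻¹),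
g(z) = g⁺(z). If the index is equal to μ, then the transformation law is f(z⁻¹) = −z⁻¹f(z). The normalization
condition g⁺(0) = 0 implies g⁻(z) = −z⁻¹g⁺(z), and we have f(z) = g(z) − zg(z⁻¹). Finally, if the index is equal to ν,
then f(z⁻¹) = −zf(z), and the normalization condition g⁻(0) = 0 implies g⁻(z) = −zg⁺(z), f(z) = g(z) − z⁻¹g(z⁻¹)."*
→ `laurent_splitting` (existence: g⁺, g⁻ = Cauchy integrals of f and of f(1/·) over circles of the ring — the
"regular and singular parts"; Cauchy's formula on two circles + the substitution w ↦ 1/w), `laurent_splitting_unique`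
(uniqueness up to a constant; Liouville), `splitting_caseS/M/N` (the three printed implications for ANY holomorphic
splitting with the stated normalisation = the one-variable content of (5.23), (5.24) and of the relations (5.25)
`g^ε = ε_με_ν z_μ^{−(1−ε_μ)/2} z_ν^{(1−ε_ν)/2} g^{(+1,…,+1)}` that turn (5.22) into (5.26); in case μ the printed
`g⁻(z) = −z⁻¹g⁺(z)` is proved for z ≠ 0 with its removable value g⁻(0) = −(g⁺)′(0)), `exists_caseS/M/N` (existence
of the normalised g).  R > 1 is the paper's e^{δ₁}; "analytic on" an open set = `DifferentiableOn ℂ` (as in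
`B12Sec5Algebra` §I).  NOT HERE: the d-variable bookkeeping "applying these representations … to each variable
separately" ((5.22)/(5.26) on the polyring — joint analyticity of parametrised Cauchy integrals), (5.27)–(5.29)
(row `B12.Eq5.27-5.29`).  READING NOTE (not adjudicated): the render of (5.24) prints the subscript ε_μ in both
members, whereas the prose normalises g⁺(0) = 0 for the index μ and g⁻(0) = 0 for the index ν; the theorems follow
the prose and (5.25).  NOTHING of the series' RG content is asserted; kernel-checked one-variable complex analysis,
every hypothesis displayed, standard axioms.  Unit `lit-balaban-p10`, HOME `run/shared/lean/pub/lit-balaban/`.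
-/

namespace Literature.MathematicalPhysics.QuantumFieldTheory.Balaban1983to89.B12LaurentSplitting522Proof

noncomputable section

open _root_.Complex _root_.MeasureTheory _root_.Metric _root_.Set _root_.Filter
open scoped Real Topology NNReal

/-! ## §0. Private Mathlib-level helpers: the ring, Cauchy on two circles, w ↦ 1/w, Liouville glue -/

/-- The ring `{R⁻¹ < |z| < R}` is open. [folklore] -/
private theorem isOpen_ring (R : ℝ) : IsOpen {z : ℂ | R⁻¹ < ‖z‖ ∧ ‖z‖ < R} :=
  (isOpen_lt continuous_const continuous_norm).and (isOpen_lt continuous_norm continuous_const)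

/-- The ring is symmetric under `z ↦ z⁻¹`. [folklore] -/
private theorem inv_mem_ring {R : ℝ} (hR : 1 < R) {z : ℂ} (h₁ : R⁻¹ < ‖z‖) (h₂ : ‖z‖ < R) :
    R⁻¹ < ‖z⁻¹‖ ∧ ‖z⁻¹‖ < R := by
  have hR0 : 0 < R := by linarith
  have hz0 : 0 < ‖z‖ := lt_trans (inv_pos.2 hR0) h₁
  rw [norm_inv]
  exact ⟨(inv_lt_inv₀ hR0 hz0).2 h₂, (inv_inv R) ▸ (inv_lt_inv₀ hz0 (inv_pos.2 hR0)).2 h₁⟩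

/-- Points of the ring are nonzero. [folklore] -/
private theorem ne_zero_of_mem_ring {R : ℝ} (hR : 1 < R) {z : ℂ} (h₁ : R⁻¹ < ‖z‖) : z ≠ 0 := by
  have : 0 < ‖z‖ := lt_trans (inv_pos.2 (by linarith)) h₁
  exact norm_pos_iff.1 this

/-- A circle of radius `ρ ∈ (R⁻¹, R)` lies in the ring. [folklore] -/
private theorem sphere_subset_ring {R ρ : ℝ} (h₁ : R⁻¹ < ρ) (h₂ : ρ < R) :
    sphere (0 : ℂ) ρ ⊆ {z : ℂ | R⁻¹ < ‖z‖ ∧ ‖z‖ < R} := fun w hw => by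
  rw [mem_sphere_zero_iff_norm] at hw
  exact ⟨hw ▸ h₁, hw ▸ h₂⟩

/-- The Cauchy kernel `(w − z)⁻¹ g(w)` is circle integrable on a circle missing `z` where `g` is continuous.
[folklore] -/
private theorem circleIntegrable_kernel {g : ℂ → ℂ} {ρ : ℝ} (hρ : 0 ≤ ρ)
    (hg : ContinuousOn g (sphere (0 : ℂ) ρ)) {z : ℂ} (hz : ‖z‖ ≠ ρ) :
    CircleIntegrable (fun w => (w - z)⁻¹ • g w) 0 ρ := by
  refine ContinuousOn.circleIntegrable hρ (ContinuousOn.fun_smul ?_ hg)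
  refine (continuousOn_id.sub continuousOn_const).inv₀ fun w hw => sub_ne_zero.2 ?_
  rw [mem_sphere_zero_iff_norm] at hw
  rintro rfl
  exact hz hw

/-- Change of variables `v = 1/w` in a circle integral: `∮_{|v| = 1/r} F(v) dv = ∮_{|w| = r} w⁻² F(1/w) dw`
(orientation reversal and `dv = −w⁻² dw` compensate; θ ↦ −θ and 2π-periodicity). [folklore] -/
private theorem circleIntegral_inv_subst (F : ℂ → ℂ) {r : ℝ} (hr : 0 < r) :
    (∮ v in C(0, r⁻¹), F v) = ∮ w in C(0, r), (w ^ 2)⁻¹ * F w⁻¹ := by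
  have key : ∀ θ : ℝ, (circleMap 0 r θ)⁻¹ = circleMap 0 r⁻¹ (-θ) := fun θ => by
    simp only [circleMap_zero, ofReal_neg, ofReal_inv, neg_mul, Complex.exp_neg, mul_inv]
  set G : ℝ → ℂ := fun θ => deriv (circleMap 0 r⁻¹) θ • F (circleMap 0 r⁻¹ θ) with hG
  have hper : Function.Periodic G (2 * π) := fun θ => by
    simp only [hG, deriv_circleMap, periodic_circleMap 0 r⁻¹ θ]
  have hpt : ∀ θ : ℝ,
      deriv (circleMap 0 r) θ • ((circleMap 0 r θ ^ 2)⁻¹ * F (circleMap 0 r θ)⁻¹) = G (-θ) := fun θ => by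
    have hne : circleMap 0 r θ ≠ 0 := circleMap_ne_center hr.ne'
    simp only [hG, deriv_circleMap, smul_eq_mul, ← key]
    field_simp
  have h2 : (∫ θ in (0 : ℝ)..2 * π, G θ) = ∫ θ in (-(2 * π))..(-(2 * π)) + 2 * π, G θ := by
    rw [hper.intervalIntegral_add_eq (-(2 * π)) 0, zero_add]
  have h3 : (∫ θ in (0 : ℝ)..2 * π, G (-θ)) = ∫ θ in (-(2 * π))..0, G θ := by
    rw [intervalIntegral.integral_comp_neg, neg_zero]
  have h4 : (∮ w in C(0, r), (w ^ 2)⁻¹ * F w⁻¹) = ∫ θ in (0 : ℝ)..2 * π, G (-θ) := by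
    simp only [circleIntegral, hpt]
  rw [show (∮ v in C(0, r⁻¹), F v) = ∫ θ in (0 : ℝ)..2 * π, G θ from rfl, h2, neg_add_cancel, h4, h3]

/-- Cauchy–Goursat between two circles of the ring for the Cauchy kernel of `f` holomorphic on the ring, the pole
`z` lying off the closed annulus between them. [folklore] -/
private theorem annulus_transfer {R : ℝ} (hR : 1 < R) {f : ℂ → ℂ}
    (hf : DifferentiableOn ℂ f {z : ℂ | R⁻¹ < ‖z‖ ∧ ‖z‖ < R})
    {a b : ℝ} (ha : R⁻¹ < a) (hab : a ≤ b) (hb : b < R) {z : ℂ} (hz : ‖z‖ < a ∨ b < ‖z‖) :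
    (∮ w in C(0, b), (w - z)⁻¹ • f w) = ∮ w in C(0, a), (w - z)⁻¹ • f w := by
  have h0a : 0 < a := lt_trans (inv_pos.2 (by linarith)) ha
  have hne : ∀ w : ℂ, a ≤ ‖w‖ → ‖w‖ ≤ b → w - z ≠ 0 := fun w h1 h2 => by
    rw [sub_ne_zero]
    rintro rfl
    rcases hz with h | h <;> linarith
  have hmem : ∀ w ∈ closedBall (0 : ℂ) b \ ball 0 a, a ≤ ‖w‖ ∧ ‖w‖ ≤ b := fun w hw => by
    rw [Set.mem_sdiff, mem_closedBall_zero_iff, mem_ball_zero_iff, not_lt] at hw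
    exact ⟨hw.2, hw.1⟩
  refine Complex.circleIntegral_eq_of_differentiable_on_annulus_off_countable h0a hab countable_empty ?_ ?_
  · refine ContinuousOn.fun_smul ?_ (hf.continuousOn.mono fun w hw => ?_)
    · exact (continuousOn_id.sub continuousOn_const).inv₀ fun w hw => hne w (hmem w hw).1 (hmem w hw).2
    · exact ⟨lt_of_lt_of_le ha (hmem w hw).1, lt_of_le_of_lt (hmem w hw).2 hb⟩
  · rintro w ⟨hw, -⟩
    rw [Set.mem_sdiff, mem_ball_zero_iff, mem_closedBall_zero_iff, not_le] at hw
    exact ((differentiableAt_id.sub_const z).inv (hne w hw.2.le hw.1.le)).fun_smul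
      (hf.differentiableAt ((isOpen_ring R).mem_nhds ⟨lt_trans ha hw.2, lt_trans hw.1 hb⟩))

/-- Radius independence of the Cauchy integral for a pole inside both circles. [folklore] -/
private theorem cauchy_indep_inner {R : ℝ} (hR : 1 < R) {f : ℂ → ℂ}
    (hf : DifferentiableOn ℂ f {z : ℂ | R⁻¹ < ‖z‖ ∧ ‖z‖ < R})
    {a b : ℝ} (ha : R⁻¹ < a) (ha' : a < R) (hb : R⁻¹ < b) (hb' : b < R)
    {z : ℂ} (hza : ‖z‖ < a) (hzb : ‖z‖ < b) :
    (∮ w in C(0, a), (w - z)⁻¹ • f w) = ∮ w in C(0, b), (w - z)⁻¹ • f w := by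
  rcases le_total a b with h | h
  · exact (annulus_transfer hR hf ha h hb' (Or.inl hza)).symm
  · exact annulus_transfer hR hf hb h ha' (Or.inl hzb)

/-- **Cauchy's formula on two circles of the ring** (the Laurent expansion mechanism): for `r < |z| < s`,
`∮_{|w|=r} f(w)(w − z)⁻¹dw = ∮_{|w|=s} f(w)(w − z)⁻¹dw − 2πi f(z)` — Cauchy–Goursat on the annulus applied to
`dslope f z`. [folklore] -/
private theorem two_circles {R : ℝ} (hR : 1 < R) {f : ℂ → ℂ}
    (hf : DifferentiableOn ℂ f {z : ℂ | R⁻¹ < ‖z‖ ∧ ‖z‖ < R})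
    {r s : ℝ} (hr : R⁻¹ < r) (hs : s < R) {z : ℂ} (hrz : r < ‖z‖) (hzs : ‖z‖ < s) :
    (∮ w in C(0, r), (w - z)⁻¹ • f w) = (∮ w in C(0, s), (w - z)⁻¹ • f w) - (2 * π * I : ℂ) • f z := by
  have h0r : 0 < r := lt_trans (inv_pos.2 (by linarith)) hr
  have hzring : z ∈ {z : ℂ | R⁻¹ < ‖z‖ ∧ ‖z‖ < R} := ⟨lt_trans hr hrz, lt_trans hzs hs⟩
  have hsub : closedBall (0 : ℂ) s \ ball 0 r ⊆ {z : ℂ | R⁻¹ < ‖z‖ ∧ ‖z‖ < R} := fun w hw => by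
    rw [Set.mem_sdiff, mem_closedBall_zero_iff, mem_ball_zero_iff, not_lt] at hw
    exact ⟨lt_of_lt_of_le hr hw.2, lt_of_le_of_lt hw.1 hs⟩
  have hS : closedBall (0 : ℂ) s \ ball 0 r ∈ 𝓝 z := by
    refine mem_of_superset ((isOpen_ball.sdiff isClosed_closedBall).mem_nhds ⟨mem_ball_zero_iff.2 hzs,
      fun h => ?_⟩) fun w hw => ⟨ball_subset_closedBall hw.1, fun h => hw.2 (ball_subset_closedBall h)⟩
    rw [mem_closedBall_zero_iff] at h
    linarith
  have hc : ContinuousOn (dslope f z) (closedBall (0 : ℂ) s \ ball 0 r) :=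
    (continuousOn_dslope hS).2 ⟨hf.continuousOn.mono hsub,
      hf.differentiableAt ((isOpen_ring R).mem_nhds hzring)⟩
  have hd : ∀ w ∈ (ball (0 : ℂ) s \ closedBall 0 r) \ {z}, DifferentiableAt ℂ (dslope f z) w := by
    rintro w ⟨hw, h3⟩
    rw [Set.mem_sdiff, mem_ball_zero_iff, mem_closedBall_zero_iff, not_le] at hw
    exact (differentiableAt_dslope_of_ne fun h => h3 (by simpa using h)).2
      (hf.differentiableAt ((isOpen_ring R).mem_nhds ⟨lt_trans hr hw.2, lt_trans hw.1 hs⟩))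
  have key := Complex.circleIntegral_eq_of_differentiable_on_annulus_off_countable h0r (by linarith)
    (countable_singleton z) hc hd
  -- evaluate the two `dslope` integrals
  have hds : ∀ ρ : ℝ, 0 < ρ → R⁻¹ < ρ → ρ < R → ‖z‖ ≠ ρ → (∮ w in C(0, ρ), dslope f z w) =
      (∮ w in C(0, ρ), (w - z)⁻¹ • f w) - (∮ w in C(0, ρ), (w - z)⁻¹) • f z := by
    intro ρ hρ hρ1 hρ2 hzρ
    rw [← circleIntegral.integral_smul_const, ← circleIntegral.integral_sub
      (circleIntegrable_kernel hρ.le (hf.continuousOn.mono (sphere_subset_ring hρ1 hρ2)) hzρ)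
      (circleIntegrable_kernel hρ.le continuousOn_const hzρ)]
    refine circleIntegral.integral_congr hρ.le fun w hw => ?_
    have hwz : w ≠ z := by
      rintro rfl
      exact hzρ (mem_sphere_zero_iff_norm.1 hw)
    simp only [dslope_of_ne _ hwz, slope_def_module, smul_sub]
  have inner_zero : (∮ w in C(0, r), (w - z)⁻¹) = 0 := by
    have hne : ∀ w : ℂ, ‖w‖ ≤ r → w - z ≠ 0 := fun w hw => by
      rw [sub_ne_zero]
      rintro rfl
      linarith
    refine Complex.circleIntegral_eq_zero_of_differentiable_on_off_countable h0r.le countable_empty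
      ((continuousOn_id.sub continuousOn_const).inv₀ fun w hw => hne w (mem_closedBall_zero_iff.1 hw)) ?_
    rintro w ⟨hw, -⟩
    exact (differentiableAt_id.sub_const z).inv (hne w (mem_ball_zero_iff.1 hw).le)
  rw [hds s (by linarith) (by linarith) hs hzs.ne, hds r h0r hr (by linarith) hrz.ne',
    circleIntegral.integral_sub_inv_of_mem_ball (mem_ball_zero_iff.2 hzs), inner_zero, zero_smul,
    sub_zero] at key
  exact key.symm

/-- The Cauchy integral over a fixed circle is holomorphic inside it (sum of `cauchyPowerSeries`). [folklore] -/
private theorem differentiableAt_cauchy_fixed {g : ℂ → ℂ} {s : ℝ} (hs : 0 < s)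
    (hci : CircleIntegrable g 0 s) {z : ℂ} (hz : ‖z‖ < s) :
    DifferentiableAt ℂ (fun z => (2 * π * I : ℂ)⁻¹ • ∮ w in C(0, s), (w - z)⁻¹ • g w) z := by
  lift s to ℝ≥0 using hs.le
  have hdo := (hasFPowerSeriesOn_cauchy_integral hci (by exact_mod_cast hs)).differentiableOn
  rw [Metric.eball_coe] at hdo
  exact hdo.differentiableAt (isOpen_ball.mem_nhds (mem_ball_zero_iff.2 hz))

/-- The moving radius `ρ(z) = (max(|z|, 1) + R)/2` lies in `(R⁻¹, R)`, above `|z|` and above 1. [folklore] -/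
private theorem rad_props {R : ℝ} (hR : 1 < R) {z : ℂ} (hz : ‖z‖ < R) :
    R⁻¹ < (max ‖z‖ 1 + R) / 2 ∧ (max ‖z‖ 1 + R) / 2 < R ∧ ‖z‖ < (max ‖z‖ 1 + R) / 2 ∧
      1 < (max ‖z‖ 1 + R) / 2 := by
  have hRinv : R⁻¹ < 1 := inv_lt_one_of_one_lt₀ hR
  have h1 : 1 ≤ max ‖z‖ 1 := le_max_right _ _
  have h2 : ‖z‖ ≤ max ‖z‖ 1 := le_max_left _ _
  have h3 : max ‖z‖ 1 < R := max_lt hz hR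
  exact ⟨by linarith, by linarith, by linarith, by linarith⟩

/-- The "regular part" `z ↦ (2πi)⁻¹ ∮_{|w| = ρ(z)} g(w)(w − z)⁻¹ dw` is holomorphic on the disc `|z| < R` when `g`
is holomorphic on the ring (locally the radius may be frozen, by `cauchy_indep_inner`). [folklore] -/
private theorem differentiableOn_regularPart {R : ℝ} (hR : 1 < R) {g : ℂ → ℂ}
    (hg : DifferentiableOn ℂ g {z : ℂ | R⁻¹ < ‖z‖ ∧ ‖z‖ < R}) :
    DifferentiableOn ℂ
      (fun z => (2 * π * I : ℂ)⁻¹ • ∮ w in C(0, (max ‖z‖ 1 + R) / 2), (w - z)⁻¹ • g w) (ball 0 R) := by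
  intro z₀ hz₀
  rw [mem_ball_zero_iff] at hz₀
  obtain ⟨h1, h2, h3, h4⟩ := rad_props hR hz₀
  have hci : CircleIntegrable g 0 ((max ‖z₀‖ 1 + R) / 2) :=
    (hg.continuousOn.mono (sphere_subset_ring h1 h2)).circleIntegrable (by linarith)
  refine ((differentiableAt_cauchy_fixed (by linarith) hci h3).congr_of_eventuallyEq ?_).differentiableWithinAt
  have hev : ∀ᶠ z in 𝓝 z₀, ‖z‖ < (max ‖z₀‖ 1 + R) / 2 ∧ ‖z‖ < R :=
    ((isOpen_lt continuous_norm continuous_const).and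
      (isOpen_lt continuous_norm continuous_const)).mem_nhds ⟨h3, hz₀⟩
  refine hev.mono fun z hz => ?_
  obtain ⟨k1, k2, k3, -⟩ := rad_props hR hz.2
  simp only
  rw [cauchy_indep_inner hR hg k1 k2 h1 h2 k3 hz.1]

/-- **Liouville glue.** Two functions holomorphic on the disc `|z| < R` (`R > 1`) exchanged by `z ↦ z⁻¹` on the
ring glue to a bounded entire function, so both equal the constant `φ(0)`. [folklore] -/
private theorem glue_const {R : ℝ} (hR : 1 < R) (φ ψ : ℂ → ℂ)
    (hφ : DifferentiableOn ℂ φ (ball 0 R)) (hψ : DifferentiableOn ℂ ψ (ball 0 R))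
    (h : ∀ z : ℂ, R⁻¹ < ‖z‖ → ‖z‖ < R → φ z = ψ z⁻¹) :
    (∀ z ∈ ball (0 : ℂ) R, φ z = φ 0) ∧ ∀ w ∈ ball (0 : ℂ) R, ψ w = φ 0 := by
  have hR0 : 0 < R := by linarith
  have hRinv : R⁻¹ < 1 := inv_lt_one_of_one_lt₀ hR
  set Φ : ℂ → ℂ := fun z => if ‖z‖ ≤ 1 then φ z else ψ z⁻¹ with hΦ
  have hΦφ : ∀ z : ℂ, ‖z‖ < R → Φ z = φ z := fun z hz => by
    by_cases h1 : ‖z‖ ≤ 1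
    · simp [hΦ, h1]
    · simp only [hΦ, h1, if_false]
      exact (h z (by linarith) hz).symm
  have hΦψ : ∀ z : ℂ, 1 < ‖z‖ → Φ z = ψ z⁻¹ := fun z hz => by simp [hΦ, not_le.mpr hz]
  have hdiff : Differentiable ℂ Φ := fun z => by
    by_cases hz : ‖z‖ < R
    · refine (hφ.differentiableAt (isOpen_ball.mem_nhds (by simpa using hz))).congr_of_eventuallyEq ?_
      have hev : ∀ᶠ w in 𝓝 z, ‖w‖ < R := (isOpen_lt continuous_norm continuous_const).mem_nhds hz
      exact hev.mono fun w hw => hΦφ w hw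
    · push Not at hz
      have hz1 : 1 < ‖z‖ := lt_of_lt_of_le hR hz
      have hz0 : z ≠ 0 := norm_pos_iff.1 (by linarith)
      have hzi : ‖z⁻¹‖ < R := by
        rw [norm_inv]
        exact lt_of_le_of_lt (inv_anti₀ hR0 hz) (by linarith)
      refine (((hψ.differentiableAt (isOpen_ball.mem_nhds (by simpa using hzi))).comp z
        (differentiableAt_inv hz0)).congr_of_eventuallyEq ?_)
      have hev : ∀ᶠ w in 𝓝 z, 1 < ‖w‖ := (isOpen_lt continuous_const continuous_norm).mem_nhds hz1
      exact hev.mono fun w hw => hΦψ w hw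
  have hsub : closedBall (0 : ℂ) 1 ⊆ ball 0 R := closedBall_subset_ball hR
  obtain ⟨M, hM⟩ :=
    (isCompact_closedBall (0 : ℂ) 1).exists_bound_of_continuousOn (hφ.continuousOn.mono hsub)
  obtain ⟨M', hM'⟩ :=
    (isCompact_closedBall (0 : ℂ) 1).exists_bound_of_continuousOn (hψ.continuousOn.mono hsub)
  have hbdd : Bornology.IsBounded (Set.range Φ) := by
    refine isBounded_iff_forall_norm_le.2 ⟨max M M', ?_⟩
    rintro _ ⟨z, rfl⟩
    by_cases h1 : ‖z‖ ≤ 1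
    · rw [show Φ z = φ z by simp [hΦ, h1]]
      exact (hM z (by simpa using h1)).trans (le_max_left _ _)
    · push Not at h1
      rw [hΦψ z h1]
      refine (hM' _ ?_).trans (le_max_right _ _)
      simpa only [mem_closedBall, dist_zero_right, norm_inv] using inv_le_one_of_one_le₀ h1.le
  have hconst := hdiff.apply_eq_apply_of_bounded hbdd
  have hΦ0 : Φ 0 = φ 0 := hΦφ 0 (by simpa using hR0)
  have hφc : ∀ z ∈ ball (0 : ℂ) R, φ z = φ 0 := fun z hz => by
    rw [← hΦφ z (mem_ball_zero_iff.1 hz), hconst z 0, hΦ0]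
  have hψc : ∀ w : ℂ, w ≠ 0 → ‖w‖ < R → ψ w = φ 0 := fun w hw0 hw => by
    have hwpos : 0 < ‖w‖ := norm_pos_iff.2 hw0
    by_cases h1 : R⁻¹ < ‖w‖
    · obtain ⟨hwi1, hwi2⟩ := inv_mem_ring hR h1 hw
      have e := h w⁻¹ hwi1 hwi2
      rw [inv_inv] at e
      exact e ▸ hφc _ (mem_ball_zero_iff.2 hwi2)
    · push Not at h1
      have e := hΦψ w⁻¹ (by rw [norm_inv]; exact (one_lt_inv₀ hwpos).2 (lt_of_le_of_lt h1 hRinv))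
      rw [inv_inv] at e
      rw [← e, hconst w⁻¹ 0, hΦ0]
  refine ⟨hφc, fun w hw => ?_⟩
  by_cases hw0 : w = 0
  · subst hw0
    have hev : ψ =ᶠ[𝓝[≠] (0 : ℂ)] fun _ => φ 0 := by
      rw [Filter.EventuallyEq, eventually_nhdsWithin_iff]
      have hb : ∀ᶠ w in 𝓝 (0 : ℂ), ‖w‖ < R :=
        (isOpen_lt continuous_norm continuous_const).mem_nhds (by simpa using hR0)
      exact hb.mono fun w hw' hw0' => hψc w hw0' hw'
    exact tendsto_nhds_unique
      (((hψ.continuousOn.continuousAt (isOpen_ball.mem_nhds hw)).tendsto).mono_left nhdsWithin_le_nhds)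
      (tendsto_const_nhds.congr' hev.symm)
  · exact hψc w hw0 (mem_ball_zero_iff.1 hw)

/-! ## §1. p. 294: the splitting `f(z) = g⁺(z) + g⁻(z⁻¹)` on the ring — existence, uniqueness -/

/-- **Laurent splitting, p. 294 [PDF 46]**, verbatim: *"a given function f(z) analytic on the ring
{e^{−δ₁} < |z| < e^{δ₁}} can be represented as f(z) = g⁺(z) + g⁻(z⁻¹), where g⁺(z), g⁻(z) are analytic on the disc
{|z| < e^{δ₁}}. This representation is obtained by taking regular and singular parts of the Laurent expansion."*
Typed reading: R = e^{δ₁} > 1, "analytic on" = `DifferentiableOn ℂ`; witnesses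
`g⁺(z) = (2πi)⁻¹∮_{|w|=ρ(z)} f(w)(w − z)⁻¹dw − (2πi)⁻¹∮_{|w|=(1+R)/2} f(w)w⁻¹dw`,
`g⁻(z) = (2πi)⁻¹∮_{|w|=ρ(z)} f(w⁻¹)(w − z)⁻¹dw`, ρ(z) = (max(|z|,1) + R)/2. [cite: Balaban1987RG1, (5.22) p.294] -/
theorem laurent_splitting {R : ℝ} (hR : 1 < R) (f : ℂ → ℂ)
    (hf : DifferentiableOn ℂ f {z : ℂ | R⁻¹ < ‖z‖ ∧ ‖z‖ < R}) :
    ∃ gp gm : ℂ → ℂ, DifferentiableOn ℂ gp (ball 0 R) ∧ DifferentiableOn ℂ gm (ball 0 R) ∧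
      ∀ z : ℂ, R⁻¹ < ‖z‖ → ‖z‖ < R → f z = gp z + gm z⁻¹ := by
  have hR0 : 0 < R := by linarith
  have hRinv : R⁻¹ < 1 := inv_lt_one_of_one_lt₀ hR
  have hfi : DifferentiableOn ℂ (fun z => f z⁻¹) {z : ℂ | R⁻¹ < ‖z‖ ∧ ‖z‖ < R} := fun z hz =>
    ((hf.differentiableAt ((isOpen_ring R).mem_nhds (inv_mem_ring hR hz.1 hz.2))).comp z
      (differentiableAt_inv (ne_zero_of_mem_ring hR hz.1))).differentiableWithinAt
  refine ⟨fun z => ((2 * π * I : ℂ)⁻¹ • ∮ w in C(0, (max ‖z‖ 1 + R) / 2), (w - z)⁻¹ • f w) -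
      (2 * π * I : ℂ)⁻¹ • ∮ w in C(0, (1 + R) / 2), (w - 0)⁻¹ • f w,
    fun z => (2 * π * I : ℂ)⁻¹ • ∮ w in C(0, (max ‖z‖ 1 + R) / 2), (w - z)⁻¹ • f w⁻¹,
    (differentiableOn_regularPart hR hf).sub_const _, differentiableOn_regularPart hR hfi, ?_⟩
  intro z hz1 hz2
  have hz0 : z ≠ 0 := ne_zero_of_mem_ring hR hz1
  have hzpos : 0 < ‖z‖ := norm_pos_iff.2 hz0
  obtain ⟨hi1, hi2⟩ := inv_mem_ring hR hz1 hz2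
  obtain ⟨hs1, hs2, hs3, -⟩ := rad_props hR hz2
  obtain ⟨ht1, ht2, ht3, ht4⟩ := rad_props hR hi2
  -- outer radius s = ρ(z); inner radius t⁻¹, t = ρ(z⁻¹)
  set s := (max ‖z‖ 1 + R) / 2 with hs_eq
  set t := (max ‖z⁻¹‖ 1 + R) / 2 with ht_eq
  have htpos : 0 < t := by linarith
  have hr1 : R⁻¹ < t⁻¹ := (inv_lt_inv₀ hR0 htpos).2 ht2
  have hr2 : t⁻¹ < ‖z‖ := inv_lt_of_inv_lt₀ hzpos (by rwa [norm_inv] at ht3)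
  have hr3 : t⁻¹ < R := lt_trans (inv_lt_one_of_one_lt₀ ht4) hR
  have hrpos : 0 < t⁻¹ := inv_pos.2 htpos
  have hcont : ContinuousOn f (sphere (0 : ℂ) t⁻¹) := hf.continuousOn.mono (sphere_subset_ring hr1 hr3)
  -- (A) substitution w ↦ 1/w in the integral defining g⁻(z⁻¹); (B) partial fractions on |w| = t⁻¹
  have hA : (∮ v in C(0, t), (v - z⁻¹)⁻¹ • f v⁻¹) =
      ∮ w in C(0, t⁻¹), (w ^ 2)⁻¹ * ((w⁻¹ - z⁻¹)⁻¹ • f w⁻¹⁻¹) := by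
    simpa only [inv_inv] using circleIntegral_inv_subst (fun v => (v - z⁻¹)⁻¹ • f v⁻¹) hrpos
  have hB : (∮ w in C(0, t⁻¹), (w ^ 2)⁻¹ * ((w⁻¹ - z⁻¹)⁻¹ • f w⁻¹⁻¹)) =
      ∮ w in C(0, t⁻¹), ((w - 0)⁻¹ • f w - (w - z)⁻¹ • f w) := by
    refine circleIntegral.integral_congr hrpos.le fun w hw => ?_
    rw [mem_sphere_zero_iff_norm] at hw
    have hw0 : w ≠ 0 := norm_pos_iff.1 (hw ▸ hrpos)
    have hzw : z ≠ w := fun h => hr2.ne' (h ▸ hw)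
    have hwz : w - z ≠ 0 := sub_ne_zero.2 (Ne.symm hzw)
    have hzw' : z - w ≠ 0 := sub_ne_zero.2 hzw
    simp only [inv_inv, smul_eq_mul, sub_zero]
    rw [inv_sub_inv hw0 hz0]
    field_simp
    ring
  -- (C) split; (D) the constant term is radius independent; (E) Cauchy on the two circles
  have hC : (∮ w in C(0, t⁻¹), ((w - 0)⁻¹ • f w - (w - z)⁻¹ • f w)) =
      (∮ w in C(0, t⁻¹), (w - 0)⁻¹ • f w) - ∮ w in C(0, t⁻¹), (w - z)⁻¹ • f w :=
    circleIntegral.integral_sub (circleIntegrable_kernel hrpos.le hcont (by rw [norm_zero]; exact hrpos.ne))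
      (circleIntegrable_kernel hrpos.le hcont hr2.ne')
  have hD : (∮ w in C(0, t⁻¹), (w - 0)⁻¹ • f w) = ∮ w in C(0, (1 + R) / 2), (w - 0)⁻¹ • f w :=
    cauchy_indep_inner hR hf hr1 hr3 (by linarith) (by linarith) (by rw [norm_zero]; exact hrpos)
      (by rw [norm_zero]; linarith)
  have hE : (∮ w in C(0, t⁻¹), (w - z)⁻¹ • f w) =
      (∮ w in C(0, s), (w - z)⁻¹ • f w) - (2 * π * I : ℂ) • f z := two_circles hR hf hr1 hs2 hr2 hs3
  have h2πI : (2 * π * I : ℂ) ≠ 0 := by simp [Real.pi_ne_zero, I_ne_zero]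
  simp only
  rw [hA, hB, hC, hD, hE]
  simp only [smul_eq_mul]
  field_simp
  ring

/-- **Uniqueness, p. 294 [PDF 46]**, verbatim: *"It is unique up to an additive constant"*: two splittings
`g⁺(z) + g⁻(z⁻¹) = G⁺(z) + G⁻(z⁻¹)` on the ring with all pieces holomorphic on the disc satisfy `G⁺ = g⁺ + c`,
`G⁻ = g⁻ − c` (Liouville glue of `G⁺ − g⁺` with `(g⁻ − G⁻)(1/·)`). [cite: Balaban1987RG1, (5.22) p.294] -/
theorem laurent_splitting_unique {R : ℝ} (hR : 1 < R) (gp gm Gp Gm : ℂ → ℂ)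
    (hgp : DifferentiableOn ℂ gp (ball 0 R)) (hgm : DifferentiableOn ℂ gm (ball 0 R))
    (hGp : DifferentiableOn ℂ Gp (ball 0 R)) (hGm : DifferentiableOn ℂ Gm (ball 0 R))
    (h : ∀ z : ℂ, R⁻¹ < ‖z‖ → ‖z‖ < R → gp z + gm z⁻¹ = Gp z + Gm z⁻¹) :
    ∃ c : ℂ, (∀ z ∈ ball (0 : ℂ) R, Gp z = gp z + c) ∧ ∀ z ∈ ball (0 : ℂ) R, Gm z = gm z - c := by
  obtain ⟨h1, h2⟩ := glue_const hR (fun z => Gp z - gp z) (fun z => gm z - Gm z) (hGp.fun_sub hgp)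
    (hgm.fun_sub hGm) fun z hz1 hz2 => by linear_combination -(h z hz1 hz2)
  exact ⟨Gp 0 - gp 0, fun z hz => by linear_combination h1 z hz, fun z hz => by linear_combination -(h2 z hz)⟩

/-! ## §2. pp. 294–295: the three normalised splittings ((5.23)–(5.25) in one variable) -/

/-- **Index ∉ {μ, ν} (or any index when μ = ν), p. 294 [PDF 46]**, verbatim: *"the transformation law in the one
variable is f(z⁻¹) = f(z). The normalization condition g⁺(0) = g⁻(0) implies then g⁻(z) = g⁺(z), and we have the
representation f(z) = g(z) + g(z⁻¹), g(z) = g⁺(z)."* — for ANY holomorphic splitting `f = g⁺ + g⁻(1/·)` (the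
one-variable normalisation (5.23); the form `B12Sec5Algebra.opS`). [cite: Balaban1987RG1, (5.23) p.294] -/
theorem splitting_caseS {R : ℝ} (hR : 1 < R) (f gp gm : ℂ → ℂ)
    (hgp : DifferentiableOn ℂ gp (ball 0 R)) (hgm : DifferentiableOn ℂ gm (ball 0 R))
    (hsplit : ∀ z : ℂ, R⁻¹ < ‖z‖ → ‖z‖ < R → f z = gp z + gm z⁻¹)
    (hlaw : ∀ z : ℂ, R⁻¹ < ‖z‖ → ‖z‖ < R → f z⁻¹ = f z) (hnorm : gp 0 = gm 0) :
    (∀ z ∈ ball (0 : ℂ) R, gm z = gp z) ∧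
      ∀ z : ℂ, R⁻¹ < ‖z‖ → ‖z‖ < R → f z = gp z + gp z⁻¹ := by
  obtain ⟨h1, -⟩ := glue_const hR (fun z => gm z - gp z) (fun z => gm z - gp z) (hgm.fun_sub hgp)
    (hgm.fun_sub hgp) fun z hz1 hz2 => by
      obtain ⟨hi1, hi2⟩ := inv_mem_ring hR hz1 hz2
      have e2 := hsplit z⁻¹ hi1 hi2
      rw [inv_inv] at e2
      linear_combination hsplit z hz1 hz2 - e2 + hlaw z hz1 hz2
  have hgm_eq : ∀ z ∈ ball (0 : ℂ) R, gm z = gp z := fun z hz => by linear_combination h1 z hz - hnorm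
  refine ⟨hgm_eq, fun z hz1 hz2 => ?_⟩
  rw [hsplit z hz1 hz2, hgm_eq _ (mem_ball_zero_iff.2 (inv_mem_ring hR hz1 hz2).2)]

/-- **Index = μ, p. 294 [PDF 46]**, verbatim: *"If the index is equal to μ, then the transformation law is
f(z⁻¹) = −z⁻¹f(z). The normalization condition g⁺(0) = 0 implies g⁻(z) = −z⁻¹g⁺(z), and we have
f(z) = g(z) − zg(z⁻¹)."* — for ANY holomorphic splitting with g⁺(0) = 0: the printed `g⁻(z) = −z⁻¹g⁺(z)` for z ≠ 0,
its removable value g⁻(0) = −(g⁺)′(0), and the form `B12Sec5Algebra.opM` (one-variable (5.24)–(5.25), index μ).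
[cite: Balaban1987RG1, (5.24)–(5.25) pp.294–295] -/
theorem splitting_caseM {R : ℝ} (hR : 1 < R) (f gp gm : ℂ → ℂ)
    (hgp : DifferentiableOn ℂ gp (ball 0 R)) (hgm : DifferentiableOn ℂ gm (ball 0 R))
    (hsplit : ∀ z : ℂ, R⁻¹ < ‖z‖ → ‖z‖ < R → f z = gp z + gm z⁻¹)
    (hlaw : ∀ z : ℂ, R⁻¹ < ‖z‖ → ‖z‖ < R → f z⁻¹ = -z⁻¹ * f z) (hnorm : gp 0 = 0) :
    (∀ z ∈ ball (0 : ℂ) R, z ≠ 0 → gm z = -z⁻¹ * gp z) ∧ gm 0 = -deriv gp 0 ∧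
      ∀ z : ℂ, R⁻¹ < ‖z‖ → ‖z‖ < R → f z = gp z - z * gp z⁻¹ := by
  have hR0 : 0 < R := by linarith
  have hq : DifferentiableOn ℂ (dslope gp 0) (ball 0 R) :=
    (Complex.differentiableOn_dslope (isOpen_ball.mem_nhds (mem_ball_self hR0))).2 hgp
  have hq_ne : ∀ z : ℂ, z ≠ 0 → dslope gp 0 z = z⁻¹ * gp z := fun z hz => by
    rw [dslope_of_ne _ hz, slope_def_module, hnorm, sub_zero, sub_zero, smul_eq_mul]
  -- glue h(z) = g⁻(z) + z⁻¹g⁺(z) (holomorphic thanks to g⁺(0) = 0) with −w h(w): h(z) = −z⁻¹ h(z⁻¹) on the ring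
  obtain ⟨h1, h2⟩ := glue_const hR (fun z => gm z + dslope gp 0 z) (fun w => -w * (gm w + dslope gp 0 w))
    (hgm.fun_add hq) ((differentiableOn_id.fun_neg).fun_mul (hgm.fun_add hq)) fun z hz1 hz2 => by
      obtain ⟨hi1, hi2⟩ := inv_mem_ring hR hz1 hz2
      have hz0 : z ≠ 0 := ne_zero_of_mem_ring hR hz1
      have e2 := hsplit z⁻¹ hi1 hi2
      rw [inv_inv] at e2
      have hzz : z⁻¹ * z = 1 := inv_mul_cancel₀ hz0
      rw [hq_ne z hz0, hq_ne z⁻¹ (inv_ne_zero hz0), inv_inv]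
      linear_combination hlaw z hz1 hz2 - e2 - z⁻¹ * hsplit z hz1 hz2 + gp z⁻¹ * hzz
  have hφ0 : ∀ z ∈ ball (0 : ℂ) R, gm z + dslope gp 0 z = 0 := fun z hz => by
    rw [h1 z hz, ← h2 0 (mem_ball_self hR0), neg_zero, zero_mul]
  refine ⟨fun z hz hz0 => ?_, ?_, fun z hz1 hz2 => ?_⟩
  · have e := hφ0 z hz
    rw [hq_ne z hz0] at e
    linear_combination e
  · have e := hφ0 0 (mem_ball_self hR0)
    rw [dslope_same] at e
    linear_combination e
  · have hz0 : z ≠ 0 := ne_zero_of_mem_ring hR hz1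
    have e := hφ0 z⁻¹ (mem_ball_zero_iff.2 (inv_mem_ring hR hz1 hz2).2)
    rw [hq_ne z⁻¹ (inv_ne_zero hz0), inv_inv] at e
    linear_combination hsplit z hz1 hz2 + e

/-- **Index = ν, p. 294 [PDF 46]**, verbatim: *"Finally, if the index is equal to ν, then f(z⁻¹) = −zf(z), and the
normalization condition g⁻(0) = 0 implies g⁻(z) = −zg⁺(z), f(z) = g(z) − z⁻¹g(z⁻¹)."* — for ANY holomorphic
splitting with g⁻(0) = 0 (the form `B12Sec5Algebra.opN`; one-variable (5.24)–(5.25), index ν; it is the case μ for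
f(1/·), whose splitting is (g⁻, g⁺)). [cite: Balaban1987RG1, (5.24)–(5.25) pp.294–295] -/
theorem splitting_caseN {R : ℝ} (hR : 1 < R) (f gp gm : ℂ → ℂ)
    (hgp : DifferentiableOn ℂ gp (ball 0 R)) (hgm : DifferentiableOn ℂ gm (ball 0 R))
    (hsplit : ∀ z : ℂ, R⁻¹ < ‖z‖ → ‖z‖ < R → f z = gp z + gm z⁻¹)
    (hlaw : ∀ z : ℂ, R⁻¹ < ‖z‖ → ‖z‖ < R → f z⁻¹ = -z * f z) (hnorm : gm 0 = 0) :
    (∀ z ∈ ball (0 : ℂ) R, gm z = -z * gp z) ∧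
      ∀ z : ℂ, R⁻¹ < ‖z‖ → ‖z‖ < R → f z = gp z - z⁻¹ * gp z⁻¹ := by
  obtain ⟨h1, -, -⟩ := splitting_caseM hR (fun z => f z⁻¹) gm gp hgm hgp (fun z hz1 hz2 => by
      obtain ⟨hi1, hi2⟩ := inv_mem_ring hR hz1 hz2
      have e := hsplit z⁻¹ hi1 hi2
      rw [inv_inv] at e
      linear_combination e) (fun z hz1 hz2 => by
      obtain ⟨hi1, hi2⟩ := inv_mem_ring hR hz1 hz2
      exact hlaw z⁻¹ hi1 hi2) hnorm
  have hgm_eq : ∀ z ∈ ball (0 : ℂ) R, gm z = -z * gp z := fun z hz => by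
    by_cases hz0 : z = 0
    · rw [hz0, hnorm]
      ring
    · have hzz : z * z⁻¹ = 1 := mul_inv_cancel₀ hz0
      linear_combination z * h1 z hz hz0 - gm z * hzz
  refine ⟨hgm_eq, fun z hz1 hz2 => ?_⟩
  rw [hsplit z hz1 hz2, hgm_eq z⁻¹ (mem_ball_zero_iff.2 (inv_mem_ring hR hz1 hz2).2)]
  ring

/-! ## §3. Existence of the normalised representations (splitting + renormalisation of the free constant) -/

/-- **p. 294, index ∉ {μ, ν}: existence** — `f` holomorphic on the ring with `f(z⁻¹) = f(z)` ⇒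
`f(z) = g(z) + g(z⁻¹)`, `g` holomorphic on the disc (shift the free constant of `laurent_splitting` to g⁺(0) = g⁻(0),
then `splitting_caseS`). [cite: Balaban1987RG1, (5.23) p.294] -/
theorem exists_caseS {R : ℝ} (hR : 1 < R) (f : ℂ → ℂ)
    (hf : DifferentiableOn ℂ f {z : ℂ | R⁻¹ < ‖z‖ ∧ ‖z‖ < R})
    (hlaw : ∀ z : ℂ, R⁻¹ < ‖z‖ → ‖z‖ < R → f z⁻¹ = f z) :
    ∃ g : ℂ → ℂ, DifferentiableOn ℂ g (ball 0 R) ∧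
      ∀ z : ℂ, R⁻¹ < ‖z‖ → ‖z‖ < R → f z = g z + g z⁻¹ := by
  obtain ⟨gp, gm, hgp, hgm, hsplit⟩ := laurent_splitting hR f hf
  exact ⟨fun z => gp z + (gm 0 - gp 0) / 2, hgp.add_const _, (splitting_caseS hR f
    (fun z => gp z + (gm 0 - gp 0) / 2) (fun z => gm z - (gm 0 - gp 0) / 2) (hgp.add_const _)
    (hgm.sub_const _) (fun z hz1 hz2 => by rw [hsplit z hz1 hz2]; ring) hlaw (by ring)).2⟩

/-- **p. 294, index = μ: existence** — `f` holomorphic on the ring with `f(z⁻¹) = −z⁻¹f(z)` ⇒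
`f(z) = g(z) − zg(z⁻¹)`, `g` holomorphic on the disc with `g(0) = 0` (normalisation g⁺(0) = 0; `splitting_caseM`).
[cite: Balaban1987RG1, (5.24)–(5.25) pp.294–295] -/
theorem exists_caseM {R : ℝ} (hR : 1 < R) (f : ℂ → ℂ)
    (hf : DifferentiableOn ℂ f {z : ℂ | R⁻¹ < ‖z‖ ∧ ‖z‖ < R})
    (hlaw : ∀ z : ℂ, R⁻¹ < ‖z‖ → ‖z‖ < R → f z⁻¹ = -z⁻¹ * f z) :
    ∃ g : ℂ → ℂ, DifferentiableOn ℂ g (ball 0 R) ∧ g 0 = 0 ∧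
      ∀ z : ℂ, R⁻¹ < ‖z‖ → ‖z‖ < R → f z = g z - z * g z⁻¹ := by
  obtain ⟨gp, gm, hgp, hgm, hsplit⟩ := laurent_splitting hR f hf
  exact ⟨fun z => gp z - gp 0, hgp.sub_const _, by simp, (splitting_caseM hR f (fun z => gp z - gp 0)
    (fun z => gm z + gp 0) (hgp.sub_const _) (hgm.add_const _)
    (fun z hz1 hz2 => by rw [hsplit z hz1 hz2]; ring) hlaw (by simp)).2.2⟩

/-- **p. 294, index = ν: existence** — `f` holomorphic on the ring with `f(z⁻¹) = −zf(z)` ⇒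
`f(z) = g(z) − z⁻¹g(z⁻¹)`, `g` holomorphic on the disc (normalisation g⁻(0) = 0; `splitting_caseN`).
[cite: Balaban1987RG1, (5.24)–(5.25) pp.294–295] -/
theorem exists_caseN {R : ℝ} (hR : 1 < R) (f : ℂ → ℂ)
    (hf : DifferentiableOn ℂ f {z : ℂ | R⁻¹ < ‖z‖ ∧ ‖z‖ < R})
    (hlaw : ∀ z : ℂ, R⁻¹ < ‖z‖ → ‖z‖ < R → f z⁻¹ = -z * f z) :
    ∃ g : ℂ → ℂ, DifferentiableOn ℂ g (ball 0 R) ∧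
      ∀ z : ℂ, R⁻¹ < ‖z‖ → ‖z‖ < R → f z = g z - z⁻¹ * g z⁻¹ := by
  obtain ⟨gp, gm, hgp, hgm, hsplit⟩ := laurent_splitting hR f hf
  exact ⟨fun z => gp z + gm 0, hgp.add_const _, (splitting_caseN hR f (fun z => gp z + gm 0)
    (fun z => gm z - gm 0) (hgp.add_const _) (hgm.sub_const _)
    (fun z hz1 hz2 => by rw [hsplit z hz1 hz2]; ring) hlaw (by simp)).2⟩

end

end Literature.MathematicalPhysics.QuantumFieldTheory.Balaban1983to89.B12LaurentSplitting522Proof
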